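import Mathlib.Analysis.Fourier.FourierTransform
import Mathlib.Analysis.SpecialFunctions.ImproperIntegrals
import Mathlib.MeasureTheory.Measure.Haar.NormedSpace
import Mathlib.Analysis.Calculus.Deriv.Mul
import Literature.Analysis.Complex.StripContourShift
import HarnessLib

/-!
# Exponential decay of Fourier integrals by a contour shift inside a strip of holomorphy

Topic `Literature/Analysis/Complex`.  Theorems only (no definition, no named fact).

The classical Paley–Wiener mechanism (e.g. E. M. Stein, R. Shakarchi, *Complex Analysis*, Ch. 4,
Thm. 2.1: "if `f` is holomorphic in the strip `|Im z| < a` with moderate decrease on each horizontal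
line, then `|f̂(ξ)| ≤ B e^{-2πb|ξ|}` for `0 ≤ b < a`"), in the form consumed by the Dixmier–Malliavin
kernel construction on `ℝ` (J. Dixmier, P. Malliavin, Bull. Sci. Math. **102** (1978) 305–330, §2,
Lemme 2.4–2.6 [bib: `DixmierMalliavin1978`]; D. Hegde, arXiv:2103.05495 §3.1–3.2 [bib: `Hegde2021`]),
where the multipliers are reciprocals of even products `Π (1 + (aᵢ ξ)²)`:

* `norm_fourierIntegrand_shift` — `‖e^{-2πi x (ξ+is)} g(ξ+is)‖ = e^{2π x s} ‖g(ξ+is)‖`;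
* `norm_integral_fourierIntegrand_le_of_strip`, `norm_fourier_le_of_strip` — if `g` is continuous on the
  closed strip `{|Im z| ≤ η}`, holomorphic inside, and dominated there by an integrable `B(Re z)` with
  `B → 0` at `±∞`, then `‖𝓕 g(x)‖ = ‖∫ e^{-2πixξ} g(ξ) dξ‖ ≤ (∫ B) · e^{-2πη|x|}` for every real `x`
  (shift the line of integration to `Im z = -η·sgn x`, where `|e^{-2πixz}| = e^{-2πη|x|}`; the shift is
  the tree's `Literature.Analysis.Complex.integral_eq_integral_add_mul_I_of_strip` /
  `integral_eq_integral_sub_mul_I_of_strip`, file `StripContourShift.lean`);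
* `one_sub_mul_one_add_le_norm_one_add_sq` — the elementary inequality
  `(1 - a²s²)(1 + a²t²) ≤ |1 + (a(t+is))²|` for `a²s² ≤ 1`, and its product form;
* `norm_fourier_inv_prod_one_add_sq_le` — for a finite family `0 ≤ aᵢ` with `aᵢ η < 1` and one index
  `i₀` with `a_{i₀} > 0`:
  `‖𝓕 (ξ ↦ (Π_{i∈S} (1 + (aᵢ ξ)²))⁻¹) (x)‖ ≤ (π / a_{i₀}) · (Π_{i∈S} (1 - (aᵢ η)²))⁻¹ · e^{-2πη|x|}`,
  UNIFORM in the size of `S` once `Π (1 - (aᵢη)²)` is bounded below (e.g. `aᵢ η ≤ 2^{-(i+1)}` gives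
  `Π ≥ 1 - Σ 4^{-(i+1)} ≥ 2/3` by the Weierstrass inequality `1 - Σ xᵢ ≤ Π (1 - xᵢ)`, in the tree as
  `Literature.NumberTheory.LFunctions.RobinOscillation.one_sub_sum_le_prod`) — the annulus density
  bound of the Dixmier–Malliavin kernels `ψ(x) = ∫ e^{-2πixξ} / Π_n (1 + (2π c_n ξ)²) dξ`.

## References

* E. M. Stein, R. Shakarchi, *Complex Analysis*, Princeton (2003), Ch. 4 §2, Thm. 2.1.
* J. Dixmier, P. Malliavin, *Factorisations de fonctions et de vecteurs indéfiniment différentiables*,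
  Bull. Sci. Math. (2) 102 (1978) 305–330, §2. [DixmierMalliavin1978]
* D. Hegde, *Schwartz functions, Hadamard products, and the Dixmier–Malliavin theorem*,
  arXiv:2103.05495, §3.1–§3.2. [Hegde2021]
-/

noncomputable section

open MeasureTheory Set Filter Complex
open scoped Topology Real FourierTransform

namespace Literature.Analysis.Complex

/-! ### 1. The shifted Fourier integrand and the strip bound -/

/-- `‖e^{-2πi x z}‖ = e^{2π x Im z}`. [cite: Hegde2021, §3.2] -/
theorem norm_cexp_fourierPhase (x : ℝ) (z : ℂ) :
    ‖Complex.exp (-(2 * π * x : ℝ) * I * z)‖ = Real.exp (2 * π * x * z.im) := by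
  rw [Complex.norm_exp]
  congr 1
  simp [mul_re, mul_im]

/-- For real `ξ`, `s`, `x`: `‖e^{-2πi x (ξ + is)} g(ξ + is)‖ = e^{2π x s} ‖g(ξ + is)‖`.
[cite: Hegde2021, §3.2] -/
theorem norm_fourierIntegrand_shift (g : ℂ → ℂ) (x ξ s : ℝ) :
    ‖Complex.exp (-(2 * π * x : ℝ) * I * (ξ + s * I)) * g (ξ + s * I)‖ =
      Real.exp (2 * π * x * s) * ‖g (ξ + s * I)‖ := by
  rw [norm_mul, norm_cexp_fourierPhase]
  simp

/-- **Exponential decay of a Fourier integral by a contour shift in a strip** (Paley–Wiener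
mechanism, Stein–Shakarchi Ch. 4 Thm. 2.1): let `η ≥ 0`, `g` continuous on the closed strip
`{|Im z| ≤ η}`, holomorphic on the open strip, with `‖g z‖ ≤ B (Re z)` on the closed strip for an
integrable `B` tending to `0` at `±∞`.  Then for every real `x`,
`‖∫ e^{-2πiξx} g(ξ) dξ‖ ≤ (∫ B) e^{-2πη|x|}`.  Proof: shift the line of integration to `Im z = -η`
(`x ≥ 0`) or `Im z = η` (`x < 0`), where `|e^{-2πixz}| = e^{-2πη|x|}`; on the way `|e^{-2πixz}| ≤ 1`, so
`B` dominates the whole integrand. [cite: Hegde2021, §3.2 (proof of Claim 13)] -/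
theorem norm_integral_fourierIntegrand_le_of_strip {g : ℂ → ℂ} {η : ℝ} {B : ℝ → ℝ} (hη : 0 ≤ η)
    (hgc : ContinuousOn g {z : ℂ | |z.im| ≤ η}) (hgd : DifferentiableOn ℂ g {z : ℂ | |z.im| < η})
    (hgb : ∀ z : ℂ, |z.im| ≤ η → ‖g z‖ ≤ B z.re) (hB : Integrable B)
    (htop : Tendsto B atTop (𝓝 0)) (hbot : Tendsto B atBot (𝓝 0)) (x : ℝ) :
    ‖∫ ξ : ℝ, Complex.exp (↑(-2 * π * ξ * x) * I) • g ξ‖ ≤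
      (∫ t : ℝ, B t) * Real.exp (-(2 * π * η * |x|)) := by
  -- the integrand as a function on `ℂ`
  set h : ℂ → ℂ := fun z => Complex.exp (-(2 * π * x : ℝ) * I * z) * g z with hh_def
  have hL : (fun ξ : ℝ => Complex.exp (↑(-2 * π * ξ * x) * I) • g ξ) = fun ξ : ℝ => h ξ := by
    funext ξ
    simp only [hh_def, smul_eq_mul]
    congr 1
    push_cast
    ring_nf
  rw [hL]
  have hphase : Continuous fun z : ℂ => Complex.exp (-(2 * π * x : ℝ) * I * z) := by fun_prop
  have hphase_d : Differentiable ℂ fun z : ℂ => Complex.exp (-(2 * π * x : ℝ) * I * z) := by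
    fun_prop
  -- norm of `h` on a horizontal line
  have hnorm : ∀ z : ℂ, ‖h z‖ = Real.exp (2 * π * x * z.im) * ‖g z‖ := fun z => by
    simp only [hh_def, norm_mul, norm_cexp_fourierPhase]
  -- the bound after the shift: `∫ ‖h (ξ + iσ)‖ ≤ e^{2πxσ} ∫ B` for `|σ| ≤ η`
  have hafter : ∀ σ : ℝ, |σ| ≤ η →
      ‖∫ ξ : ℝ, h (ξ + σ * I)‖ ≤ (∫ t : ℝ, B t) * Real.exp (2 * π * x * σ) := by
    intro σ hσ
    refine (norm_integral_le_integral_norm _).trans ?_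
    have hpt : ∀ ξ : ℝ, ‖h (ξ + σ * I)‖ ≤ Real.exp (2 * π * x * σ) * B ξ := fun ξ => by
      rw [hnorm]
      have him : ((ξ : ℂ) + σ * I).im = σ := by simp
      have hre : ((ξ : ℂ) + σ * I).re = ξ := by simp
      rw [him]
      gcongr
      simpa [hre] using hgb (ξ + σ * I) (by simpa [him] using hσ)
    calc ∫ ξ : ℝ, ‖h (ξ + σ * I)‖ ≤ ∫ ξ : ℝ, Real.exp (2 * π * x * σ) * B ξ :=
          integral_mono_of_nonneg (ae_of_all _ fun _ => norm_nonneg _) (hB.const_mul _)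
            (ae_of_all _ hpt)
      _ = (∫ t : ℝ, B t) * Real.exp (2 * π * x * σ) := by rw [integral_const_mul, mul_comm]
  by_cases hx : 0 ≤ x
  · -- shift DOWN to `Im z = -η`
    have hxs : 2 * π * x * (-η) = -(2 * π * η * |x|) := by rw [abs_of_nonneg hx]; ring
    have hc : ContinuousOn h {z : ℂ | -η ≤ z.im ∧ z.im ≤ 0} :=
      (hphase.continuousOn.mul (hgc.mono fun z hz => abs_le.2 ⟨hz.1, hz.2.trans hη⟩))
    have hd : DifferentiableOn ℂ h {z : ℂ | -η < z.im ∧ z.im < 0} :=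
      hphase_d.differentiableOn.mul (hgd.mono fun z hz => abs_lt.2 ⟨hz.1, hz.2.trans_le hη⟩)
    have hb : ∀ z : ℂ, -η ≤ z.im → z.im ≤ 0 → ‖h z‖ ≤ B z.re := fun z h1 h2 => by
      rw [hnorm]
      have hgz := hgb z (abs_le.2 ⟨h1, h2.trans hη⟩)
      have hexp : Real.exp (2 * π * x * z.im) ≤ 1 := by
        rw [Real.exp_le_one_iff]
        have : 0 ≤ 2 * π * x := by positivity
        nlinarith
      calc Real.exp (2 * π * x * z.im) * ‖g z‖ ≤ 1 * ‖g z‖ := by gcongr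
        _ ≤ B z.re := by rw [one_mul]; exact hgz
    rw [integral_eq_integral_sub_mul_I_of_strip hη hc hd hb hB htop hbot]
    have e1 : (fun ξ : ℝ => h (ξ - η * I)) = fun ξ : ℝ => h (ξ + ((-η : ℝ) : ℂ) * I) := by
      funext ξ; congr 1; push_cast; ring
    rw [e1, ← hxs]
    exact hafter (-η) (by simp [abs_of_nonneg hη])
  · -- shift UP to `Im z = η`
    have hx' : x < 0 := not_le.1 hx
    have hxs : 2 * π * x * η = -(2 * π * η * |x|) := by rw [abs_of_neg hx']; ring
    have hc : ContinuousOn h {z : ℂ | 0 ≤ z.im ∧ z.im ≤ η} :=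
      (hphase.continuousOn.mul (hgc.mono fun z hz => abs_le.2 ⟨by linarith [hz.1], hz.2⟩))
    have hd : DifferentiableOn ℂ h {z : ℂ | 0 < z.im ∧ z.im < η} :=
      hphase_d.differentiableOn.mul (hgd.mono fun z hz => abs_lt.2 ⟨by linarith [hz.1], hz.2⟩)
    have hb : ∀ z : ℂ, 0 ≤ z.im → z.im ≤ η → ‖h z‖ ≤ B z.re := fun z h1 h2 => by
      rw [hnorm]
      have hgz := hgb z (abs_le.2 ⟨by linarith, h2⟩)
      have hexp : Real.exp (2 * π * x * z.im) ≤ 1 := by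
        rw [Real.exp_le_one_iff]
        have : 2 * π * x ≤ 0 := by
          have : (0 : ℝ) < 2 * π := by positivity
          nlinarith
        nlinarith
      calc Real.exp (2 * π * x * z.im) * ‖g z‖ ≤ 1 * ‖g z‖ := by gcongr
        _ ≤ B z.re := by rw [one_mul]; exact hgz
    rw [integral_eq_integral_add_mul_I_of_strip hη hc hd hb hB htop hbot, ← hxs]
    exact hafter η (by simp [abs_of_nonneg hη])

/-- The same bound for Mathlib's Fourier transform `𝓕 f (x) = ∫ e^{-2πiξx} f(ξ) dξ` of the restriction
`f` of `g` to the real line: `‖𝓕 f x‖ ≤ (∫ B) e^{-2πη|x|}`. [cite: Hegde2021, §3.2 (proof of Claim 13)] -/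
theorem norm_fourier_le_of_strip {f : ℝ → ℂ} {g : ℂ → ℂ} {η : ℝ} {B : ℝ → ℝ} (hη : 0 ≤ η)
    (hgc : ContinuousOn g {z : ℂ | |z.im| ≤ η}) (hgd : DifferentiableOn ℂ g {z : ℂ | |z.im| < η})
    (hgb : ∀ z : ℂ, |z.im| ≤ η → ‖g z‖ ≤ B z.re) (hB : Integrable B)
    (htop : Tendsto B atTop (𝓝 0)) (hbot : Tendsto B atBot (𝓝 0))
    (hfg : ∀ ξ : ℝ, g ξ = f ξ) (x : ℝ) :
    ‖𝓕 f x‖ ≤ (∫ t : ℝ, B t) * Real.exp (-(2 * π * η * |x|)) := by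
  rw [Real.fourier_real_eq_integral_exp_smul]
  simp_rw [← hfg]
  exact norm_integral_fourierIntegrand_le_of_strip hη hgc hgd hgb hB htop hbot x

/-! ### 2. The even quadratic factors `1 + (a z)²` on a strip -/

/-- Real and imaginary parts of `1 + (a(t + is))²`. [cite: Hegde2021, §3.2] -/
theorem one_add_sq_re_im (a t s : ℝ) :
    (1 + ((a : ℂ) * (t + s * I)) ^ 2).re = 1 + a ^ 2 * t ^ 2 - a ^ 2 * s ^ 2 ∧
      (1 + ((a : ℂ) * (t + s * I)) ^ 2).im = 2 * a ^ 2 * t * s := by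
  constructor
  · simp [sq, mul_re, mul_im]; ring
  · simp [sq, mul_re, mul_im]; ring

/-- **The elementary strip inequality** `(1 - a²s²)(1 + a²t²) ≤ |1 + (a(t + is))²|` for `a²s² ≤ 1`:
indeed `|1 + (a(t+is))²|² - (1 - a²s²)²(1 + a²t²)² = uv(6 + 2u - 2v - uv) ≥ 0` with `u = a²t²`,
`v = a²s² ≤ 1`. [cite: Hegde2021, §3.2 (proof of Claim 13)] -/
theorem one_sub_mul_one_add_le_norm_one_add_sq (a t s : ℝ) (h : a ^ 2 * s ^ 2 ≤ 1) :
    (1 - a ^ 2 * s ^ 2) * (1 + a ^ 2 * t ^ 2) ≤ ‖1 + ((a : ℂ) * (t + s * I)) ^ 2‖ := by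
  set w : ℂ := 1 + ((a : ℂ) * (t + s * I)) ^ 2 with hw
  obtain ⟨hre, him⟩ := one_add_sq_re_im a t s
  have hu : 0 ≤ a ^ 2 * t ^ 2 := by positivity
  have hv : 0 ≤ a ^ 2 * s ^ 2 := by positivity
  have hlhs : 0 ≤ (1 - a ^ 2 * s ^ 2) * (1 + a ^ 2 * t ^ 2) := mul_nonneg (sub_nonneg.2 h) (by positivity)
  have hsq : ‖w‖ ^ 2 = (1 + a ^ 2 * t ^ 2 - a ^ 2 * s ^ 2) ^ 2 + (2 * a ^ 2 * t * s) ^ 2 := by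
    rw [Complex.sq_norm, Complex.normSq_apply, hre, him]; ring
  have hkey : ((1 - a ^ 2 * s ^ 2) * (1 + a ^ 2 * t ^ 2)) ^ 2 ≤ ‖w‖ ^ 2 := by
    rw [hsq]
    have hid : (1 + a ^ 2 * t ^ 2 - a ^ 2 * s ^ 2) ^ 2 + (2 * a ^ 2 * t * s) ^ 2 -
        ((1 - a ^ 2 * s ^ 2) * (1 + a ^ 2 * t ^ 2)) ^ 2 =
        (a ^ 2 * t ^ 2) * (a ^ 2 * s ^ 2) * ((4 + a ^ 2 * t ^ 2) + 2 * (1 - a ^ 2 * s ^ 2) +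
          (a ^ 2 * t ^ 2) * (1 - a ^ 2 * s ^ 2)) := by ring
    have hpos : 0 ≤ (a ^ 2 * t ^ 2) * (a ^ 2 * s ^ 2) * ((4 + a ^ 2 * t ^ 2) +
        2 * (1 - a ^ 2 * s ^ 2) + (a ^ 2 * t ^ 2) * (1 - a ^ 2 * s ^ 2)) := by
      have h1 : 0 ≤ 1 - a ^ 2 * s ^ 2 := sub_nonneg.2 h
      positivity
    linarith
  exact (pow_le_pow_iff_left₀ hlhs (norm_nonneg w) two_ne_zero).1 hkey

/-- Product form: `Π_{i∈S} (1 - aᵢ²s²)(1 + aᵢ²t²) ≤ |Π_{i∈S} (1 + (aᵢ(t + is))²)|` when `aᵢ²s² ≤ 1`.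
[cite: Hegde2021, §3.2 (proof of Claim 13)] -/
theorem prod_one_sub_mul_one_add_le_norm_prod {ι : Type*} (S : Finset ι) (a : ι → ℝ) (t s : ℝ)
    (h : ∀ i ∈ S, a i ^ 2 * s ^ 2 ≤ 1) :
    ∏ i ∈ S, (1 - a i ^ 2 * s ^ 2) * (1 + a i ^ 2 * t ^ 2) ≤
      ‖∏ i ∈ S, (1 + ((a i : ℂ) * (t + s * I)) ^ 2)‖ := by
  rw [norm_prod]
  exact Finset.prod_le_prod (fun i hi => mul_nonneg (sub_nonneg.2 (h i hi)) (by positivity))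
    fun i hi => one_sub_mul_one_add_le_norm_one_add_sq (a i) t s (h i hi)

/-! ### 3. Reciprocals of finite even products: the Dixmier–Malliavin multipliers -/

/-- **Exponential decay of `𝓕 (Π (1 + (aᵢξ)²))⁻¹`, uniform in the number of factors.**  Let `S` be a
finite index set, `0 ≤ aᵢ` (`i ∈ S`), `i₀ ∈ S` with `a_{i₀} > 0`, and `η ≥ 0` with `aᵢ η < 1` for all
`i ∈ S`.  Then for every real `x`,
`‖𝓕 (ξ ↦ (Π_{i∈S} (1 + (aᵢξ)²))⁻¹) (x)‖ ≤ (π / a_{i₀}) (Π_{i∈S} (1 - (aᵢη)²))⁻¹ e^{-2πη|x|}`.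
Proof: `norm_fourier_le_of_strip` with the dominator `B(t) = (Π(1 - (aᵢη)²))⁻¹ (1 + (a_{i₀}t)²)⁻¹`
supplied by `prod_one_sub_mul_one_add_le_norm_prod`, and `∫ (1 + (a t)²)⁻¹ dt = π / a`.  (The factors
`1 + (aᵢ z)²` have no zero in the strip `|Im z| ≤ η < 1/aᵢ`.)  With `aᵢ = 2π cᵢ` this is the horizontal-line
estimate behind the Dixmier–Malliavin kernels `ψ̂ = 1/Π (1 + (2πcᵢξ)²)`.
[cite: Hegde2021, §3.2 Claim 13 (annulus form); DixmierMalliavin1978, §2 Lemme 2.5] -/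
theorem norm_fourier_inv_prod_one_add_sq_le {ι : Type*} (S : Finset ι) (a : ι → ℝ) {i₀ : ι}
    (hi₀ : i₀ ∈ S) (ha : ∀ i ∈ S, 0 ≤ a i) (ha₀ : 0 < a i₀) {η : ℝ} (hη : 0 ≤ η)
    (hη' : ∀ i ∈ S, a i * η < 1) (x : ℝ) :
    ‖𝓕 (fun ξ : ℝ => (((∏ i ∈ S, (1 + (a i * ξ) ^ 2))⁻¹ : ℝ) : ℂ)) x‖ ≤
      π / a i₀ * (∏ i ∈ S, (1 - (a i * η) ^ 2))⁻¹ * Real.exp (-(2 * π * η * |x|)) := by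
  classical
  -- the holomorphic extension and the dominator
  set P : ℂ → ℂ := fun z => ∏ i ∈ S, (1 + ((a i : ℂ) * z) ^ 2) with hP_def
  set g : ℂ → ℂ := fun z => (P z)⁻¹ with hg_def
  set K : ℝ := (∏ i ∈ S, (1 - (a i * η) ^ 2))⁻¹ with hK_def
  set B : ℝ → ℝ := fun t => K * (1 + (a i₀ * t) ^ 2)⁻¹ with hB_def
  have hfac_pos : ∀ i ∈ S, 0 < 1 - (a i * η) ^ 2 := fun i hi => by
    have h1 : 0 ≤ a i * η := mul_nonneg (ha i hi) hη
    have h2 : (a i * η) ^ 2 < 1 := by nlinarith [hη' i hi]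
    linarith
  have hprod_pos : 0 < ∏ i ∈ S, (1 - (a i * η) ^ 2) := Finset.prod_pos hfac_pos
  have hK_pos : 0 < K := inv_pos.2 hprod_pos
  -- `a_i² s² ≤ (a_i η)² ≤ 1` on the closed strip
  have hsq_le : ∀ i ∈ S, ∀ s : ℝ, |s| ≤ η → a i ^ 2 * s ^ 2 ≤ (a i * η) ^ 2 := fun i hi s hs => by
    have h1 : |a i * s| ≤ a i * η := by
      rw [abs_mul, abs_of_nonneg (ha i hi)]
      exact mul_le_mul_of_nonneg_left hs (ha i hi)
    have h2 : (a i * s) ^ 2 ≤ (a i * η) ^ 2 := by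
      rw [← sq_abs (a i * s)]
      exact pow_le_pow_left₀ (abs_nonneg _) h1 2
    nlinarith [h2]
  have hsq_le_one : ∀ i ∈ S, ∀ s : ℝ, |s| ≤ η → a i ^ 2 * s ^ 2 ≤ 1 := fun i hi s hs =>
    (hsq_le i hi s hs).trans (by nlinarith [hfac_pos i hi])
  -- the lower bound for `|P|` on the closed strip
  have hP_lower : ∀ t s : ℝ, |s| ≤ η →
      (∏ i ∈ S, (1 - (a i * η) ^ 2)) * (1 + (a i₀ * t) ^ 2) ≤ ‖P (t + s * I)‖ := by
    intro t s hs
    have step1 := prod_one_sub_mul_one_add_le_norm_prod S a t s (fun i hi => hsq_le_one i hi s hs)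
    refine le_trans ?_ step1
    -- compare factor by factor after splitting off `i₀`
    rw [← Finset.mul_prod_erase S _ hi₀, ← Finset.mul_prod_erase S
      (fun i => (1 - a i ^ 2 * s ^ 2) * (1 + a i ^ 2 * t ^ 2)) hi₀]
    have hA : (1 - (a i₀ * η) ^ 2) * (1 + (a i₀ * t) ^ 2) ≤
        (1 - a i₀ ^ 2 * s ^ 2) * (1 + a i₀ ^ 2 * t ^ 2) := by
      have := hsq_le i₀ hi₀ s hs
      have h3 : 0 ≤ 1 + a i₀ ^ 2 * t ^ 2 := by positivity
      nlinarith
    have hBd : ∏ i ∈ S.erase i₀, (1 - (a i * η) ^ 2) ≤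
        ∏ i ∈ S.erase i₀, (1 - a i ^ 2 * s ^ 2) * (1 + a i ^ 2 * t ^ 2) := by
      refine Finset.prod_le_prod (fun i hi => (hfac_pos i (Finset.mem_of_mem_erase hi)).le)
        fun i hi => ?_
      have hi' := Finset.mem_of_mem_erase hi
      have := hsq_le i hi' s hs
      have h3 : 0 ≤ a i ^ 2 * t ^ 2 := by positivity
      have h4 : 0 ≤ 1 - a i ^ 2 * s ^ 2 := sub_nonneg.2 (hsq_le_one i hi' s hs)
      nlinarith
    calc (1 - (a i₀ * η) ^ 2) * (∏ i ∈ S.erase i₀, (1 - (a i * η) ^ 2)) * (1 + (a i₀ * t) ^ 2)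
        = ((1 - (a i₀ * η) ^ 2) * (1 + (a i₀ * t) ^ 2)) *
            ∏ i ∈ S.erase i₀, (1 - (a i * η) ^ 2) := by ring
      _ ≤ ((1 - a i₀ ^ 2 * s ^ 2) * (1 + a i₀ ^ 2 * t ^ 2)) *
            ∏ i ∈ S.erase i₀, (1 - a i ^ 2 * s ^ 2) * (1 + a i ^ 2 * t ^ 2) :=
          mul_le_mul hA hBd (Finset.prod_nonneg fun i hi => (hfac_pos i (Finset.mem_of_mem_erase hi)).le)
            (mul_nonneg (sub_nonneg.2 (hsq_le_one i₀ hi₀ s hs)) (by positivity))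
  have hP_pos : ∀ t s : ℝ, |s| ≤ η → 0 < ‖P (t + s * I)‖ := fun t s hs =>
    lt_of_lt_of_le (mul_pos hprod_pos (by positivity)) (hP_lower t s hs)
  have hP_ne : ∀ z : ℂ, |z.im| ≤ η → P z ≠ 0 := fun z hz => by
    have := hP_pos z.re z.im hz
    rw [Complex.re_add_im] at this
    exact norm_pos_iff.1 this
  -- holomorphy
  have hP_diff : Differentiable ℂ P := by
    rw [hP_def]
    fun_prop
  have hg_at : ∀ z : ℂ, |z.im| ≤ η → DifferentiableAt ℂ g z := fun z hz =>
    ((hP_diff z).inv (hP_ne z hz))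
  have hgc : ContinuousOn g {z : ℂ | |z.im| ≤ η} := fun z hz =>
    (hg_at z hz).continuousAt.continuousWithinAt
  have hgd : DifferentiableOn ℂ g {z : ℂ | |z.im| < η} := fun z hz =>
    (hg_at z (le_of_lt hz)).differentiableWithinAt
  -- the dominator
  have hgb : ∀ z : ℂ, |z.im| ≤ η → ‖g z‖ ≤ B z.re := fun z hz => by
    have hlow := hP_lower z.re z.im hz
    rw [Complex.re_add_im] at hlow
    have hden : 0 < (∏ i ∈ S, (1 - (a i * η) ^ 2)) * (1 + (a i₀ * z.re) ^ 2) :=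
      mul_pos hprod_pos (by positivity)
    rw [hg_def, norm_inv, hB_def, hK_def]
    simp only
    rw [← mul_inv]
    exact inv_anti₀ hden hlow
  have hB_int : Integrable B :=
    (integrable_inv_one_add_sq.comp_mul_left' ha₀.ne').const_mul K
  have hB_top : Tendsto B atTop (𝓝 0) := by
    have h1 : Tendsto (fun t : ℝ => 1 + (a i₀ * t) ^ 2) atTop atTop := by
      refine tendsto_atTop_add_const_left _ 1 ?_
      exact (tendsto_pow_atTop two_ne_zero).comp (tendsto_id.const_mul_atTop ha₀)
    simpa [hB_def] using (tendsto_inv_atTop_zero.comp h1).const_mul K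
  have hB_bot : Tendsto B atBot (𝓝 0) := by
    have := hB_top.comp tendsto_neg_atBot_atTop
    refine this.congr fun t => ?_
    simp [hB_def, Function.comp, mul_neg]
  have hB_integral : ∫ t : ℝ, B t = π / a i₀ * K := by
    simp only [hB_def]
    rw [integral_const_mul]
    have h1 : ∫ t : ℝ, (1 + (a i₀ * t) ^ 2)⁻¹ = π / a i₀ := by
      have := Measure.integral_comp_mul_left (fun y : ℝ => (1 + y ^ 2)⁻¹) (a i₀)
      rw [this, integral_univ_inv_one_add_sq, smul_eq_mul, abs_of_pos (inv_pos.2 ha₀)]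
      ring
    rw [h1]; ring
  -- restriction to the real line
  have hfg : ∀ ξ : ℝ, g ξ = (((∏ i ∈ S, (1 + (a i * ξ) ^ 2))⁻¹ : ℝ) : ℂ) := fun ξ => by
    simp only [hg_def, hP_def]
    push_cast
    rfl
  have main := norm_fourier_le_of_strip hη hgc hgd hgb hB_int hB_top hB_bot hfg x
  rw [hB_integral] at main
  simpa [hK_def, mul_comm, mul_assoc, mul_left_comm] using main


/-! ### 4. One-sided strips and a general real frequency; the inverse transform

The upper-strip / lower-strip forms (hypotheses on `{0 ≤ Im z ≤ Y}` resp. `{−Y ≤ Im z ≤ 0}` only,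
for the matching sign of the frequency), the integrand written with a general real frequency
`g(ξ) e^{itξ}`, and the `𝓕⁻` form of the two-sided statement (seat cc-t11; the Dixmier–Malliavin
consumer uses §3, these are the library complements). -/

/-- Real part of the exponent `t·z·i`: `Re(itz) = −t·Im z`. [folklore] -/
private theorem re_ofReal_mul_mul_I (t : ℝ) (z : ℂ) : ((t : ℂ) * z * I).re = -(t * z.im) := by
  simp [Complex.mul_re, Complex.mul_im]

/-- `‖g(z) e^{itz}‖ = ‖g z‖ e^{−t Im z}`. [folklore] -/
private theorem norm_mul_cexp_eq (g : ℂ → ℂ) (t : ℝ) (z : ℂ) :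
    ‖g z * cexp ((t : ℂ) * z * I)‖ = ‖g z‖ * Real.exp (-(t * z.im)) := by
  rw [norm_mul, Complex.norm_exp, re_ofReal_mul_mul_I]

/-- **Decay from an upper strip** (`t ≥ 0`): if `g` is continuous on `{0 ≤ Im z ≤ Y}`, holomorphic on
`{0 < Im z < Y}`, `‖g z‖ ≤ b(Re z)` there, `b` integrable and `→ 0` at `±∞`, then
`‖∫ g(ξ) e^{itξ} dξ‖ ≤ e^{−Yt} ∫ b`. [cite: Hegde2021, §3.2 (holomorphy of `ψ̂` in a strip);
folklore Paley–Wiener] -/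
theorem norm_integral_mul_cexp_le_of_upper_strip {g : ℂ → ℂ} {Y : ℝ} {b : ℝ → ℝ} (hY : 0 ≤ Y)
    (hgc : ContinuousOn g {z | 0 ≤ z.im ∧ z.im ≤ Y})
    (hgd : DifferentiableOn ℂ g {z | 0 < z.im ∧ z.im < Y})
    (hgb : ∀ z : ℂ, 0 ≤ z.im → z.im ≤ Y → ‖g z‖ ≤ b z.re) (hb : Integrable b)
    (htop : Tendsto b atTop (𝓝 0)) (hbot : Tendsto b atBot (𝓝 0)) {t : ℝ} (ht : 0 ≤ t) :
    ‖∫ ξ : ℝ, g ξ * cexp ((t : ℂ) * ξ * I)‖ ≤ Real.exp (-(Y * t)) * ∫ ξ : ℝ, b ξ := by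
  set G : ℂ → ℂ := fun z => g z * cexp ((t : ℂ) * z * I) with hG
  have hchar : Continuous fun z : ℂ => cexp ((t : ℂ) * z * I) := by fun_prop
  have hGc : ContinuousOn G {z | 0 ≤ z.im ∧ z.im ≤ Y} := hgc.mul hchar.continuousOn
  have hGd : DifferentiableOn ℂ G {z | 0 < z.im ∧ z.im < Y} :=
    hgd.mul (by fun_prop : Differentiable ℂ fun z : ℂ => cexp ((t : ℂ) * z * I)).differentiableOn
  have hGb : ∀ z : ℂ, 0 ≤ z.im → z.im ≤ Y → ‖G z‖ ≤ b z.re := by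
    intro z h0 _h1
    have hb0 : ‖g z‖ ≤ b z.re := hgb z h0 _h1
    have hexp : Real.exp (-(t * z.im)) ≤ 1 := by
      rw [Real.exp_le_one_iff]; nlinarith
    calc ‖G z‖ = ‖g z‖ * Real.exp (-(t * z.im)) := norm_mul_cexp_eq g t z
      _ ≤ b z.re * 1 := mul_le_mul hb0 hexp (Real.exp_pos _).le ((norm_nonneg _).trans hb0)
      _ = b z.re := mul_one _
  have key := norm_integral_le_of_strip hY hGc hGd hGb hb htop hbot
  -- on the shifted line `‖G(ξ + iY)‖ = ‖g(ξ + iY)‖ e^{-tY} ≤ b(ξ) e^{-tY}`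
  have hline : ∀ ξ : ℝ, ‖G (ξ + Y * I)‖ ≤ b ξ * Real.exp (-(Y * t)) := by
    intro ξ
    have him : ((ξ : ℂ) + Y * I).im = Y := by simp
    have hre : ((ξ : ℂ) + Y * I).re = ξ := by simp
    have hb0 := hgb ((ξ : ℂ) + Y * I) (by rw [him]; exact hY) (by rw [him])
    rw [hre] at hb0
    calc ‖G (ξ + Y * I)‖ = ‖g (ξ + Y * I)‖ * Real.exp (-(t * Y)) := by
          rw [show G (ξ + Y * I) = g (ξ + Y * I) * cexp ((t : ℂ) * (ξ + Y * I) * I) from rfl,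
            norm_mul_cexp_eq g t, him]
      _ ≤ b ξ * Real.exp (-(Y * t)) := by
          rw [mul_comm t Y]
          exact mul_le_mul_of_nonneg_right hb0 (Real.exp_pos _).le
  calc ‖∫ ξ : ℝ, g ξ * cexp ((t : ℂ) * ξ * I)‖ = ‖∫ ξ : ℝ, G ξ‖ := rfl
    _ ≤ ∫ ξ : ℝ, ‖G (ξ + Y * I)‖ := key
    _ ≤ ∫ ξ : ℝ, b ξ * Real.exp (-(Y * t)) :=
        integral_mono_of_nonneg (Eventually.of_forall fun ξ => norm_nonneg _)
          (hb.mul_const _) (Eventually.of_forall hline)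
    _ = Real.exp (-(Y * t)) * ∫ ξ : ℝ, b ξ := by
        rw [integral_mul_const, mul_comm]

/-- **Decay from a lower strip** (`t ≤ 0`): the mirrored statement on `{−Y ≤ Im z ≤ 0}`:
`‖∫ g(ξ) e^{itξ} dξ‖ ≤ e^{Yt} ∫ b = e^{−Y|t|} ∫ b`. [cite: Hegde2021, §3.2; folklore Paley–Wiener] -/
theorem norm_integral_mul_cexp_le_of_lower_strip {g : ℂ → ℂ} {Y : ℝ} {b : ℝ → ℝ} (hY : 0 ≤ Y)
    (hgc : ContinuousOn g {z | -Y ≤ z.im ∧ z.im ≤ 0})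
    (hgd : DifferentiableOn ℂ g {z | -Y < z.im ∧ z.im < 0})
    (hgb : ∀ z : ℂ, -Y ≤ z.im → z.im ≤ 0 → ‖g z‖ ≤ b z.re) (hb : Integrable b)
    (htop : Tendsto b atTop (𝓝 0)) (hbot : Tendsto b atBot (𝓝 0)) {t : ℝ} (ht : t ≤ 0) :
    ‖∫ ξ : ℝ, g ξ * cexp ((t : ℂ) * ξ * I)‖ ≤ Real.exp (Y * t) * ∫ ξ : ℝ, b ξ := by
  set G : ℂ → ℂ := fun z => g z * cexp ((t : ℂ) * z * I) with hG
  have hchar : Continuous fun z : ℂ => cexp ((t : ℂ) * z * I) := by fun_prop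
  have hGc : ContinuousOn G {z | -Y ≤ z.im ∧ z.im ≤ 0} := hgc.mul hchar.continuousOn
  have hGd : DifferentiableOn ℂ G {z | -Y < z.im ∧ z.im < 0} :=
    hgd.mul (by fun_prop : Differentiable ℂ fun z : ℂ => cexp ((t : ℂ) * z * I)).differentiableOn
  have hGb : ∀ z : ℂ, -Y ≤ z.im → z.im ≤ 0 → ‖G z‖ ≤ b z.re := by
    intro z h0 h1
    have hb0 : ‖g z‖ ≤ b z.re := hgb z h0 h1
    have hexp : Real.exp (-(t * z.im)) ≤ 1 := by
      rw [Real.exp_le_one_iff]; nlinarith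
    calc ‖G z‖ = ‖g z‖ * Real.exp (-(t * z.im)) := norm_mul_cexp_eq g t z
      _ ≤ b z.re * 1 := mul_le_mul hb0 hexp (Real.exp_pos _).le ((norm_nonneg _).trans hb0)
      _ = b z.re := mul_one _
  have hshift := integral_eq_integral_sub_mul_I_of_strip hY hGc hGd hGb hb htop hbot
  have hline : ∀ ξ : ℝ, ‖G (ξ - Y * I)‖ ≤ b ξ * Real.exp (Y * t) := by
    intro ξ
    have him : ((ξ : ℂ) - Y * I).im = -Y := by simp
    have hre : ((ξ : ℂ) - Y * I).re = ξ := by simp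
    have hb0 := hgb ((ξ : ℂ) - Y * I) (by rw [him]) (by rw [him]; linarith)
    rw [hre] at hb0
    calc ‖G (ξ - Y * I)‖ = ‖g (ξ - Y * I)‖ * Real.exp (-(t * -Y)) := by
          rw [show G (ξ - Y * I) = g (ξ - Y * I) * cexp ((t : ℂ) * (ξ - Y * I) * I) from rfl,
            norm_mul_cexp_eq g t, him]
      _ ≤ b ξ * Real.exp (Y * t) := by
          rw [show -(t * -Y) = Y * t by ring]
          exact mul_le_mul_of_nonneg_right hb0 (Real.exp_pos _).le
  calc ‖∫ ξ : ℝ, g ξ * cexp ((t : ℂ) * ξ * I)‖ = ‖∫ ξ : ℝ, G ξ‖ := rfl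
    _ = ‖∫ ξ : ℝ, G (ξ - Y * I)‖ := by rw [hshift]
    _ ≤ ∫ ξ : ℝ, ‖G (ξ - Y * I)‖ := norm_integral_le_integral_norm _
    _ ≤ ∫ ξ : ℝ, b ξ * Real.exp (Y * t) :=
        integral_mono_of_nonneg (Eventually.of_forall fun ξ => norm_nonneg _)
          (hb.mul_const _) (Eventually.of_forall hline)
    _ = Real.exp (Y * t) * ∫ ξ : ℝ, b ξ := by
        rw [integral_mul_const, mul_comm]

/-- **Decay from a two-sided strip**: if `g` is continuous on `{|Im z| ≤ Y}`, holomorphic on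
`{|Im z| < Y}`, `‖g z‖ ≤ b(Re z)` there with `b` integrable and `→ 0` at `±∞`, then for every real `t`
`‖∫ g(ξ) e^{itξ} dξ‖ ≤ e^{−Y|t|} ∫ b`. [cite: Hegde2021, §3.2; folklore Paley–Wiener] -/
theorem norm_integral_mul_cexp_le_of_two_sided_strip {g : ℂ → ℂ} {Y : ℝ} {b : ℝ → ℝ} (hY : 0 ≤ Y)
    (hgc : ContinuousOn g {z | |z.im| ≤ Y}) (hgd : DifferentiableOn ℂ g {z | |z.im| < Y})
    (hgb : ∀ z : ℂ, |z.im| ≤ Y → ‖g z‖ ≤ b z.re) (hb : Integrable b)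
    (htop : Tendsto b atTop (𝓝 0)) (hbot : Tendsto b atBot (𝓝 0)) (t : ℝ) :
    ‖∫ ξ : ℝ, g ξ * cexp ((t : ℂ) * ξ * I)‖ ≤ Real.exp (-(Y * |t|)) * ∫ ξ : ℝ, b ξ := by
  rcases le_total 0 t with ht | ht
  · rw [abs_of_nonneg ht]
    refine norm_integral_mul_cexp_le_of_upper_strip hY (hgc.mono fun z hz => ?_)
      (hgd.mono fun z hz => ?_) (fun z h0 h1 => hgb z (abs_le.2 ⟨by linarith, h1⟩)) hb htop hbot ht
    · exact abs_le.2 ⟨by linarith [hz.1], hz.2⟩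
    · exact abs_lt.2 ⟨by linarith [hz.1], hz.2⟩
  · rw [abs_of_nonpos ht, show -(Y * -t) = Y * t by ring]
    refine norm_integral_mul_cexp_le_of_lower_strip hY (hgc.mono fun z hz => ?_)
      (hgd.mono fun z hz => ?_) (fun z h0 h1 => hgb z (abs_le.2 ⟨h0, by linarith⟩)) hb htop hbot ht
    · exact abs_le.2 ⟨hz.1, by linarith [hz.2]⟩
    · exact abs_lt.2 ⟨hz.1, by linarith [hz.2]⟩

/-- **Fourier-transform form**: under the two-sided strip hypotheses,
`‖𝓕 g (w)‖ ≤ e^{−2πY|w|} ∫ b` (Mathlib's `𝓕 g (w) = ∫ e^{−2πi v w} g(v) dv`).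
[cite: Hegde2021, §3.2; folklore Paley–Wiener] -/
theorem norm_fourier_le_of_two_sided_strip {g : ℂ → ℂ} {Y : ℝ} {b : ℝ → ℝ} (hY : 0 ≤ Y)
    (hgc : ContinuousOn g {z | |z.im| ≤ Y}) (hgd : DifferentiableOn ℂ g {z | |z.im| < Y})
    (hgb : ∀ z : ℂ, |z.im| ≤ Y → ‖g z‖ ≤ b z.re) (hb : Integrable b)
    (htop : Tendsto b atTop (𝓝 0)) (hbot : Tendsto b atBot (𝓝 0)) (w : ℝ) :
    ‖𝓕 (fun v : ℝ => g v) w‖ ≤ Real.exp (-(2 * π * Y * |w|)) * ∫ ξ : ℝ, b ξ := by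
  have hrw : 𝓕 (fun v : ℝ => g v) w = ∫ ξ : ℝ, g ξ * cexp (((-(2 * π * w) : ℝ) : ℂ) * ξ * I) := by
    rw [Real.fourier_real_eq_integral_exp_smul]
    refine integral_congr_ae (Eventually.of_forall fun v => ?_)
    simp only [smul_eq_mul]
    rw [mul_comm]
    congr 2
    push_cast
    ring
  rw [hrw]
  refine (norm_integral_mul_cexp_le_of_two_sided_strip hY hgc hgd hgb hb htop hbot _).trans_eq ?_
  rw [abs_neg, abs_mul, abs_of_pos (by positivity : (0 : ℝ) < 2 * π)]
  ring_nf

/-- **Inverse-Fourier form**: `‖𝓕⁻ g (w)‖ ≤ e^{−2πY|w|} ∫ b` (`𝓕⁻ g (w) = ∫ e^{2πi v w} g(v) dv`).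
[cite: Hegde2021, §3.2; folklore Paley–Wiener] -/
theorem norm_fourierInv_le_of_two_sided_strip {g : ℂ → ℂ} {Y : ℝ} {b : ℝ → ℝ} (hY : 0 ≤ Y)
    (hgc : ContinuousOn g {z | |z.im| ≤ Y}) (hgd : DifferentiableOn ℂ g {z | |z.im| < Y})
    (hgb : ∀ z : ℂ, |z.im| ≤ Y → ‖g z‖ ≤ b z.re) (hb : Integrable b)
    (htop : Tendsto b atTop (𝓝 0)) (hbot : Tendsto b atBot (𝓝 0)) (w : ℝ) :
    ‖𝓕⁻ (fun v : ℝ => g v) w‖ ≤ Real.exp (-(2 * π * Y * |w|)) * ∫ ξ : ℝ, b ξ := by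
  have hrw : 𝓕⁻ (fun v : ℝ => g v) w = ∫ ξ : ℝ, g ξ * cexp ((((2 * π * w) : ℝ) : ℂ) * ξ * I) := by
    rw [Real.fourierInv_eq_fourier_neg, Real.fourier_real_eq_integral_exp_smul]
    refine integral_congr_ae (Eventually.of_forall fun v => ?_)
    simp only [smul_eq_mul]
    rw [mul_comm]
    congr 2
    push_cast
    ring
  rw [hrw]
  refine (norm_integral_mul_cexp_le_of_two_sided_strip hY hgc hgd hgb hb htop hbot _).trans_eq ?_
  rw [abs_mul, abs_of_pos (by positivity : (0 : ℝ) < 2 * π)]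
  ring_nf

end Literature.Analysis.Complex
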